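import Literature.NumberTheory.EllipticCurves.AtkinLehnerInvolutions
import Literature.NumberTheory.EllipticCurves.CuspFormLFunctionNewformFrickeProofs
import Literature.NumberTheory.EllipticCurves.NewformsMainLemmaTraceProofs
import Literature.NumberTheory.EllipticCurves.HeckeOperatorsDiamondProofs
import HarnessLib

/-!
# The Atkin–Lehner involutions `w_Q`: one-term formula, `w_Q² = 1`, and
`a_p(f) = −p^{k/2−1} λ(p)` for `p ∥ N` (proofs for `AtkinLehnerInvolutions`)

A `…Proofs` sibling (theorems only: no definition, no named fact, no instance) of
`Literature.NumberTheory.EllipticCurves.AtkinLehnerInvolutions`, which defines the Atkin–Lehner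
involution `atkinLehnerInvolution N k Q = Q^{1−k/2} • [Γ₀(N) w(Q) Γ₀(N)]` on `S_k(Γ₀(N))` for the
canonical matrix `w(Q) = atkinLehnerW N Q = β(Q) diag(Q, 1)`, `β(Q) = (x y; N/Q Q) ∈ SL(2, ℤ)`, and
its eigenvalue `atkinLehnerEigenvalue f Q` (`…At p` versions at `Q_p = p^{v_p(N)}`). Here we prove
the parts of Knapp 1993, Lemma 9.24 and Thm. 9.27 (Atkin–Lehner 1970, §2 and Thm. 3) that the
root-number files consume and that pin down the normalisation of these definitions:

* `glCast_atkinLehnerW`, `atkinLehnerW_mul_mul_inv_mem`, `isDoubleCosetDecomp_atkinLehnerW`: for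
  `Q ∥ N` (`Q ∣ N`, `gcd(Q, N/Q) = 1`) the matrix `w(Q)` normalises `Γ₀(N)` (Knapp, proof of Lemma 9.24,
  PDF p. 215; here from `exists_beta_tpD_mul_eq` of `NewformsMainLemmaTraceProofs`, whose shape
  `β diag(q, 1)` the definition of `w(Q)` was chosen to match), so `Γ₀(N) w(Q) Γ₀(N) = Γ₀(N) w(Q)`;
* `atkinLehnerInvolution_apply_eq_slash` — **one-term formula** `w_Q f = Q^{1−k/2} • (f ∣[k] w(Q))`
  (double coset formula `coe_cuspHeckeCorrespondence_eq_sum` with one representative), i.e. Knapp's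
  `w_Q f = f ∘ [w(Q)]_k` for his `det^{k/2}`-normalised slash action;
* `atkinLehnerInvolution_atkinLehnerInvolution` — **`w_Q² = 1`** (Knapp, Lemma 9.24): `w(Q)² = γ₀ (Q·1)`
  with `γ₀ ∈ Γ₀(N)` (`exists_beta_tpD_mul_self`) and `f ∣[k] (Q·1) = Q^{k−2} f` (`slash_tpD_mul_tpG`),
  `Q^{2−k} Q^{k−2} = 1`; hence eigenvalues of eigenvectors are `±1`
  (`eq_one_or_eq_neg_one_of_atkinLehnerInvolution_eq_smul`);
* `atkinLehnerInvolution_eq_neg_smul_heckeT` — for `p ∥ N` (`N = pM`, `p ∤ M`) and `f` in the new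
  subspace (the joint kernel of the adjoint degeneracy maps, `newSubspace0`):
  **`w_p f = −p^{1−k/2} U_p f`**, from Knapp's Lemma 9.26 in kernel form
  (`coe_heckeT_eq_neg_slash_of_adjDegeneracyMap0_eq_zero` of `CuspFormLFunctionNewformFrickeProofs`:
  `U_p f = −(f ∣[k] diag(1,p) R)`), the canonical `w(p)` being of that shape
  (`exists_tpG_mul_eq_glCast_atkinLehnerW`: `w(p) = diag(1,p) (px y; M 1)`);
* `IsNewform0.atkinLehnerInvolution_eq_smul_of_not_dvd`, `IsNewform0.atkinLehnerEigenvalueAt_eq_of_not_dvd`,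
  `IsNewform0.exists_atkinLehnerInvolutionAt_eq_smul_of_not_dvd` — for a **newform** and `p ∥ N`:
  `w_p f = −p^{1−k/2} a_p(f) f` (`U_p f = a_p f`, `IsNewform0.heckeT_eq_coeff_smul`), so `f` is a
  `w_p`-eigenvector with `λ(p) = −p^{1−k/2} a_p(f) = ±1` — Knapp, Thm. 9.27(b) at `p ∥ N` (the case
  `p ∥ N` of the named fact `IsNewform0.exists_atkinLehnerInvolutionAt_eq_smul`) and
  "`c_p = −p^{k/2−1} λ(p)` if `p ∣ N` and `p² ∤ N`" (Thm. 9.27, PDF p. 218);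
* `IsNewform0.atkinLehnerEigenvalueAt_eq_neg_coeff_of_not_dvd` — weight `2`: **`λ(p) = −a_p(f)`** for
  `p ∥ N`, the input for the local root numbers of an elliptic curve at the primes of multiplicative
  reduction (`a_p = ±1` for split/non-split, so `λ(p) = ∓1`, Rohrlich's `w_p`).

Not proved here (named facts of the statement file): Thm. 9.27(b) at `p² ∣ N` and Thm. 9.27(c)
(`w_N f = ∏ λ(Q) f`).

## References

* A. W. Knapp, *Elliptic curves*, Math. Notes 40, Princeton UP 1993 (held:
  `book:knapp1993-elliptic-curves-volume-40`): Lemma 9.24 and (9.62) (PDF pp. 214–216), Lemma 9.26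
  (PDF pp. 216–217), Thm. 9.27 (PDF pp. 217–218).
* A. O. L. Atkin, J. Lehner, *Hecke operators on `Γ₀(m)`*, Math. Ann. 185 (1970), 134–160, §2,
  Lemmas 8–10, Thm. 3 (not held).
-/

noncomputable section

open scoped MatrixGroups ModularForm

open CongruenceSubgroup Matrix.SpecialLinearGroup UpperHalfPlane Complex

namespace Literature.NumberTheory.EllipticCurves.ModularForms

/-! ### The canonical Atkin–Lehner matrix normalises `Γ₀(N)` -/

section Matrices

variable (N Q : ℕ) [NeZero Q]

/-- `w(Q) = β(Q) diag(Q, 1)` in `GL(2, ℝ)`. [folklore] -/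
theorem glCast_atkinLehnerW :
    glCast (atkinLehnerW N Q : GL (Fin 2) ℚ) = mapGL ℝ (atkinLehnerSL N Q) * tpD Q := by
  rw [atkinLehnerW, Subgroup.coe_mul, glCast, map_mul]
  change glCast (slToGLPos (atkinLehnerSL N Q) : GL (Fin 2) ℚ) * tpD Q = _
  rw [glCast_slToGLPos]

/-- `det w(Q) = Q`. [folklore] -/
theorem det_glCast_atkinLehnerW :
    (glCast (atkinLehnerW N Q : GL (Fin 2) ℚ)).det.val = Q := by
  rw [glCast_atkinLehnerW, map_mul, Units.val_mul, det_tpD]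
  simp

/-- **`w(Q)` normalises `Γ₀(N)`** for `Q ∥ N` (Knapp 1993, proof of Lemma 9.24, PDF p. 215:
"we see that `w(Q) (a b; c d) w(Q)⁻¹` is in `Γ₀(N)`"); here from `exists_beta_tpD_mul_eq` of
`NewformsMainLemmaTraceProofs` (the shape `β diag(Q, 1)`). [cite: Knapp1993, Lemma 9.24] -/
theorem atkinLehnerW_mul_mul_inv_mem (hQN : Q ∣ N) (hc : Nat.Coprime Q (N / Q)) {x : GL (Fin 2) ℝ}
    (hx : x ∈ (Gamma0 N : Subgroup (GL (Fin 2) ℝ))) :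
    glCast (atkinLehnerW N Q : GL (Fin 2) ℚ) * x * (glCast (atkinLehnerW N Q : GL (Fin 2) ℚ))⁻¹ ∈
      (Gamma0 N : Subgroup (GL (Fin 2) ℝ)) := by
  obtain ⟨γ, hγ, rfl⟩ := Subgroup.mem_map.mp hx
  have hN : N = N / Q * Q := (Nat.div_mul_cancel hQN).symm
  obtain ⟨h10, h11⟩ := atkinLehnerSL_apply_one N Q hc
  obtain ⟨γ', hγ', h⟩ :=
    exists_beta_tpD_mul_eq (p := Q) hN h10 ⟨1, by rw [h11, mul_one]⟩ hγ
  rw [glCast_atkinLehnerW, h, mul_inv_cancel_right]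
  exact Subgroup.mem_map_of_mem _ hγ'

/-- The double coset `Γ₀(N) w(Q) Γ₀(N)` is the single right coset `Γ₀(N) w(Q)` (`Q ∥ N`), i.e.
`w(Q)` alone is a system of representatives (Knapp 1993, Lemma 9.24). [cite: Knapp1993, Lemma 9.24] -/
theorem isDoubleCosetDecomp_atkinLehnerW (hQN : Q ∣ N) (hc : Nat.Coprime Q (N / Q)) :
    IsDoubleCosetDecomp (Gamma0 N : Subgroup (GL (Fin 2) ℝ)) (Gamma0 N : Subgroup (GL (Fin 2) ℝ))
      (glCast (atkinLehnerW N Q : GL (Fin 2) ℚ))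
      (fun _ : Unit ↦ glCast (atkinLehnerW N Q : GL (Fin 2) ℚ)) where
  mem _ := DoubleCoset.mem_doubleCoset.mpr ⟨1, one_mem _, 1, one_mem _, by simp⟩
  existsUnique x hx := by
    refine ⟨(), ?_, fun _ _ ↦ rfl⟩
    obtain ⟨γ, hγ, γ', hγ', rfl⟩ := DoubleCoset.mem_doubleCoset.mp hx
    have : γ * glCast (atkinLehnerW N Q : GL (Fin 2) ℚ) * γ' *
        (glCast (atkinLehnerW N Q : GL (Fin 2) ℚ))⁻¹ =
        γ * (glCast (atkinLehnerW N Q : GL (Fin 2) ℚ) * γ' *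
          (glCast (atkinLehnerW N Q : GL (Fin 2) ℚ))⁻¹) := by
      group
    rw [this]
    exact mul_mem hγ (atkinLehnerW_mul_mul_inv_mem N Q hQN hc hγ')

/-- **`w(Q)² ∈ Q · Γ₀(N)`** (`Q ∥ N`): `w(Q) w(Q) = γ₀ (Q · 1)` with `γ₀ ∈ Γ₀(N)` (Knapp 1993, proof
of Lemma 9.24: "we calculate that `Q⁻¹ w(Q)²` is in `Γ₀(N)`, and it follows that `w_Q² = 1`"); from
`exists_beta_tpD_mul_self` of `NewformsMainLemmaTraceProofs`. [cite: Knapp1993, Lemma 9.24] -/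
theorem exists_atkinLehnerW_mul_self (hQN : Q ∣ N) (hc : Nat.Coprime Q (N / Q)) :
    ∃ γ₀ ∈ Gamma0 N, glCast (atkinLehnerW N Q : GL (Fin 2) ℚ) *
        glCast (atkinLehnerW N Q : GL (Fin 2) ℚ) = mapGL ℝ γ₀ * (tpD Q * tpG Q) := by
  have hN : N = N / Q * Q := (Nat.div_mul_cancel hQN).symm
  obtain ⟨h10, h11⟩ := atkinLehnerSL_apply_one N Q hc
  rw [glCast_atkinLehnerW]
  exact exists_beta_tpD_mul_self (p := Q) hN h10 ⟨1, by rw [h11, mul_one]⟩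

end Matrices

/-! ### The one-term formula and `w_Q² = 1` -/

section Involution

variable (N : ℕ) [NeZero N] (k : ℤ) (Q : ℕ) [NeZero Q]

/-- **One-term formula**: for `Q ∥ N`, `w_Q f = Q^{1−k/2} • (f ∣[k] w(Q))` as functions on `ℍ`;
the trace defining the double coset operator `[Γ₀(N) w(Q) Γ₀(N)]` has the single term `f ∣[k] w(Q)`
(Knapp 1993, Lemma 9.24: `w_Q f = f ∘ [w(Q)]_k` "carries `S_k(Γ₀(N))` into itself"; his
`det^{k/2}`-normalised `f ∘ [w(Q)]_k` is `Q^{1−k/2} (f ∣[k] w(Q))` for Mathlib's slash action).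
[cite: Knapp1993, Lemma 9.24] -/
theorem atkinLehnerInvolution_apply_eq_slash (hQN : Q ∣ N) (hc : Nat.Coprime Q (N / Q))
    (f : CuspForm (Gamma0 N) k) :
    (⇑(atkinLehnerInvolution N k Q f) : ℍ → ℂ) =
      (((Q : ℝ) ^ (1 - (k : ℝ) / 2) : ℝ) : ℂ) •
        (⇑f ∣[k] glCast (atkinLehnerW N Q : GL (Fin 2) ℚ)) := by
  have h := coe_cuspHeckeCorrespondence_eq_sum (Gamma0 N) (Gamma0 N) k
    (atkinLehnerW N Q : GL (Fin 2) ℚ) (isDoubleCosetDecomp_atkinLehnerW N Q hQN hc) f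
  rw [Fintype.sum_unique] at h
  unfold atkinLehnerInvolution
  rw [LinearMap.smul_apply, CuspForm.IsGLPos.coe_smul]
  congr 1

/-- **`w_Q² = 1` on `S_k(Γ₀(N))`** for `Q ∥ N` (Knapp 1993, Lemma 9.24; Atkin–Lehner 1970, Lemma 8):
pointwise `w_Q (w_Q f) = Q^{2−k} • (f ∣[k] w(Q)²)`, `w(Q)² = γ₀ (Q · 1)` with `γ₀ ∈ Γ₀(N)`
(`exists_atkinLehnerW_mul_self`), and the scalar matrix `Q · 1` slashes by `Q^{k−2}`
(`slash_tpD_mul_tpG`). Unlike `w_N² = (−1)^k` (`w_N² = −N`), no parity of `k` intervenes.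
[cite: Knapp1993, Lemma 9.24] -/
theorem atkinLehnerInvolution_atkinLehnerInvolution (hQN : Q ∣ N) (hc : Nat.Coprime Q (N / Q))
    (f : CuspForm (Gamma0 N) k) :
    atkinLehnerInvolution N k Q (atkinLehnerInvolution N k Q f) = f := by
  have hQ0 : (Q : ℂ) ≠ 0 := by exact_mod_cast NeZero.ne Q
  apply DFunLike.coe_injective
  have h := atkinLehnerInvolution_apply_eq_slash N k Q hQN hc
  rw [h (atkinLehnerInvolution N k Q f), h f, ModularForm.smul_slash, σ_glCast, smul_smul,
    ← SlashAction.slash_mul]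
  obtain ⟨γ₀, hγ₀, hsq⟩ := exists_atkinLehnerW_mul_self N Q hQN hc
  rw [hsq, SlashAction.slash_mul,
    SlashInvariantFormClass.slash_action_eq f (mapGL ℝ γ₀) (Subgroup.mem_map_of_mem _ hγ₀),
    slash_tpD_mul_tpG Q k ⇑f, smul_smul]
  set c : ℂ := (((Q : ℝ) ^ (1 - (k : ℝ) / 2) : ℝ) : ℂ) with hc_def
  have hc' : c = (Q : ℂ) ^ (1 - (k : ℂ) / 2) := by
    rw [hc_def, Complex.ofReal_cpow (Nat.cast_nonneg Q)]
    push_cast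
    ring_nf
  have hcc : c * c = (Q : ℂ) ^ (2 - k) := by
    rw [hc', ← cpow_add _ _ hQ0, ← cpow_intCast]
    congr 1
    push_cast
    ring
  have key : c * c * (Q : ℂ) ^ (k - 2) = 1 := by
    rw [hcc, ← zpow_add₀ hQ0]
    norm_num
  rw [key, one_smul]

/-- If `w_Q f = ε • f` with `f ≠ 0` (`Q ∥ N`) then `ε = ±1` (`w_Q² = 1`; Knapp 1993, Thm. 9.27(b)).
[cite: Knapp1993, Thm. 9.27(b)] -/
theorem eq_one_or_eq_neg_one_of_atkinLehnerInvolution_eq_smul (hQN : Q ∣ N)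
    (hc : Nat.Coprime Q (N / Q)) {f : CuspForm (Gamma0 N) k} (hf : f ≠ 0) {ε : ℂ}
    (h : atkinLehnerInvolution N k Q f = ε • f) : ε = 1 ∨ ε = -1 := by
  have h2 : (ε * ε) • f = f := by
    conv_rhs => rw [← atkinLehnerInvolution_atkinLehnerInvolution N k Q hQN hc f, h, map_smul, h,
      smul_smul]
  have h3 : (ε * ε - 1) • f = 0 := by rw [sub_smul, h2, one_smul, sub_self]
  have h4 : ε * ε - 1 = 0 := (smul_eq_zero.mp h3).resolve_right hf
  have h5 : (ε - 1) * (ε + 1) = 0 := by linear_combination h4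
  rcases mul_eq_zero.mp h5 with h6 | h6
  · exact Or.inl (by linear_combination h6)
  · exact Or.inr (by linear_combination h6)

end Involution

/-! ### `p ∥ N`: `w_p = −p^{1−k/2} U_p` on the new subspace (Knapp 1993, Lemma 9.26) -/

section ExactPrime

variable (N : ℕ) [NeZero N] (k : ℤ) (p : ℕ) [Fact p.Prime]

omit [NeZero N] in
/-- For `N = p M`: `diag(1, p) R = w(p)` with `R = (p x, y; M, 1) ∈ SL(2, ℤ)`, `(x, y)` the first row
of `β(p)`; so the canonical `w(p) = β(p) diag(p, 1)` is also of the shape `diag(1,p) R`, `M ∣ R₁₀`,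
`p ∣ R₀₀` of `CuspFormLFunctionNewformFrickeProofs` (Knapp 1993, proof of Lemma 9.26: the
representative `(pα 1; Nγ/p 1)` "satisfies … `= (1/p) w(p)`"). [cite: Knapp1993, Lemma 9.26] -/
theorem exists_tpG_mul_eq_glCast_atkinLehnerW {M : ℕ} (hN : N = p * M) (hpM : ¬ p ∣ M) :
    ∃ R : SL(2, ℤ), (M : ℤ) ∣ R 1 0 ∧ (p : ℤ) ∣ R 0 0 ∧
      tpG p * mapGL ℝ R = glCast (atkinLehnerW N p : GL (Fin 2) ℚ) := by
  haveI : NeZero p := ⟨(Fact.out : p.Prime).ne_zero⟩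
  have hp0 : 0 < p := (Fact.out : p.Prime).pos
  have hM : N / p = M := by rw [hN, Nat.mul_div_cancel_left M hp0]
  have hc : Nat.Coprime p (N / p) := by
    rw [hM]; exact (Nat.Prime.coprime_iff_not_dvd Fact.out).mpr hpM
  have hb := atkinLehnerSL_bezout N p hc
  obtain ⟨h10, h11⟩ := atkinLehnerSL_apply_one N p hc
  rw [hM] at hb h10
  refine ⟨⟨!![(p : ℤ) * (atkinLehnerSL N p) 0 0, (atkinLehnerSL N p) 0 1; (M : ℤ), 1], by
    rw [Matrix.det_fin_two_of]; linear_combination hb⟩, ⟨1, by simp⟩,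
    ⟨(atkinLehnerSL N p) 0 0, by simp⟩, ?_⟩
  rw [glCast_atkinLehnerW]
  refine Units.ext ?_
  rw [Matrix.GeneralLinearGroup.coe_mul, Matrix.GeneralLinearGroup.coe_mul, val_tpG, val_tpD,
    val_mapGL', val_mapGL']
  have h10' : (((atkinLehnerSL N p) 1 0 : ℤ) : ℝ) = M := by exact_mod_cast h10
  have h11' : (((atkinLehnerSL N p) 1 1 : ℤ) : ℝ) = p := by exact_mod_cast h11
  ext i j
  fin_cases i <;> fin_cases j <;>
    simp [Matrix.mul_apply, Fin.sum_univ_two, h10', h11', mul_comm]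

/-- **`w_p f = −p^{1−k/2} U_p f` for `f ∈ S_k(Γ₀(N))^{new}` and `p ∥ N`** (Knapp 1993, Lemma 9.26:
"`T_k(p) f + p^{k/2−1} w_p f` is in `S_k(Γ₀(N/p))`", whose kernel form on the new subspace — the joint
kernel of the adjoint degeneracy maps — is `U_p f = −(f ∣[k] w(p))`,
`coe_heckeT_eq_neg_slash_of_adjDegeneracyMap0_eq_zero` of `CuspFormLFunctionNewformFrickeProofs`);
with the one-term formula `w_p f = p^{1−k/2} (f ∣[k] w(p))`. [cite: Knapp1993, Lemma 9.26] -/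
theorem atkinLehnerInvolution_eq_neg_smul_heckeT {M : ℕ} (hN : N = p * M) (hpM : ¬ p ∣ M)
    {f : CuspForm (Gamma0 N) k} (hf : f ∈ newSubspace0 N k) :
    haveI : NeZero p := ⟨(Fact.out : p.Prime).ne_zero⟩
    atkinLehnerInvolution N k p f =
      -((((p : ℝ) ^ (1 - (k : ℝ) / 2) : ℝ) : ℂ) • heckeT (Gamma0 N) k p f) := by
  haveI : NeZero p := ⟨(Fact.out : p.Prime).ne_zero⟩
  have hp : p.Prime := Fact.out
  haveI : NeZero M := ⟨by rintro rfl; exact NeZero.ne N (by rw [hN, mul_zero])⟩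
  have hM : N / p = M := by rw [hN, Nat.mul_div_cancel_left M hp.pos]
  have hc : Nat.Coprime p (N / p) := by rw [hM]; exact (Nat.Prime.coprime_iff_not_dvd hp).mpr hpM
  have hpN : p ∣ N := ⟨M, hN⟩
  have hMN : M ∈ N.properDivisors := Nat.mem_properDivisors.mpr
    ⟨⟨p, by rw [hN, mul_comm]⟩, by rw [hN]; exact lt_mul_left (NeZero.pos M) hp.one_lt⟩
  have h2 : adjDegeneracyMap0 N M p k f = 0 := by
    have := (Submodule.mem_iInf _).mp hf ⟨(M, p), hMN, by rw [hN, mul_comm]⟩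
    exact LinearMap.mem_ker.mp this
  obtain ⟨R, hR, hR0, hRW⟩ := exists_tpG_mul_eq_glCast_atkinLehnerW N p hN hpM
  apply DFunLike.coe_injective
  rw [atkinLehnerInvolution_apply_eq_slash N k p hpN hc f, CuspForm.coe_neg,
    CuspForm.IsGLPos.coe_smul,
    coe_heckeT_eq_neg_slash_of_adjDegeneracyMap0_eq_zero p N k hN hR hR0 h2, hRW, smul_neg,
    neg_neg]

variable {N k}

/-- **`w_p f = −p^{1−k/2} a_p(f) • f` for a newform `f` and `p ∥ N`**: `U_p f = a_p(f) f`
(`IsNewform0.heckeT_eq_coeff_smul`) in `w_p = −p^{1−k/2} U_p` on the new subspace. In particular a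
newform is a `w_p`-eigenvector (Knapp 1993, Thm. 9.27(b) at `p ∥ N`) with
`λ(p) = −p^{1−k/2} a_p(f)`, i.e. "`c_p = −p^{k/2−1} λ(p)` if `p ∣ N` and `p² ∤ N`" (Thm. 9.27).
[cite: Knapp1993, Thm. 9.27] -/
theorem IsNewform0.atkinLehnerInvolution_eq_smul_of_not_dvd {M : ℕ} (hN : N = p * M)
    (hpM : ¬ p ∣ M) {f : CuspForm (Gamma0 N) k} (hf : IsNewform0 f) :
    haveI : NeZero p := ⟨(Fact.out : p.Prime).ne_zero⟩
    atkinLehnerInvolution N k p f =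
      (-((((p : ℝ) ^ (1 - (k : ℝ) / 2) : ℝ) : ℂ)) * (qExpansion 1 ⇑f).coeff p) • f := by
  haveI : NeZero p := ⟨(Fact.out : p.Prime).ne_zero⟩
  rw [atkinLehnerInvolution_eq_neg_smul_heckeT N k p hN hpM hf.1,
    hf.heckeT_eq_coeff_smul (Fact.out : p.Prime), smul_smul, neg_mul]
  exact (neg_smul _ f).symm

/-- The exact power of `p` dividing `N = p M`, `p ∤ M`, is `p` itself: `p^{v_p(N)} = p`. [folklore] -/
theorem pow_factorization_eq_self_of_not_dvd {M : ℕ} (hN : N = p * M) (hpM : ¬ p ∣ M) :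
    p ^ N.factorization p = p := by
  have hp : p.Prime := Fact.out
  have hM0 : M ≠ 0 := by rintro rfl; exact NeZero.ne N (by rw [hN, mul_zero])
  rw [hN, Nat.factorization_mul hp.ne_zero hM0, Finsupp.add_apply, hp.factorization_self,
    Nat.factorization_eq_zero_of_not_dvd hpM, add_zero, pow_one]

/-- **Knapp 1993, Thm. 9.27(b) at `p ∥ N`, proved**: a newform `f ∈ S_k(Γ₀(N))`, `N = p M`,
`p ∤ M`, is an eigenvector of the Atkin–Lehner involution at `p` with eigenvalue `±1` (the case
`p ∥ N` of the named fact `IsNewform0.exists_atkinLehnerInvolutionAt_eq_smul`).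
[cite: Knapp1993, Thm. 9.27(b)] -/
theorem IsNewform0.exists_atkinLehnerInvolutionAt_eq_smul_of_not_dvd {M : ℕ} (hN : N = p * M)
    (hpM : ¬ p ∣ M) {f : CuspForm (Gamma0 N) k} (hf : IsNewform0 f) :
    ∃ ε : ℂ, (ε = 1 ∨ ε = -1) ∧ atkinLehnerInvolutionAt N k p f = ε • f := by
  haveI : NeZero p := ⟨(Fact.out : p.Prime).ne_zero⟩
  have hp : p.Prime := Fact.out
  have hM : N / p = M := by rw [hN, Nat.mul_div_cancel_left M hp.pos]
  have hc : Nat.Coprime p (N / p) := by rw [hM]; exact (Nat.Prime.coprime_iff_not_dvd hp).mpr hpM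
  have hf0 : f ≠ 0 := fun h0 ↦ hf.coe_ne_zero (by rw [h0]; rfl)
  have h := hf.atkinLehnerInvolution_eq_smul_of_not_dvd p hN hpM
  refine ⟨_, eq_one_or_eq_neg_one_of_atkinLehnerInvolution_eq_smul N k p ⟨M, hN⟩ hc hf0 h, ?_⟩
  rw [atkinLehnerInvolutionAt_eq (pow_factorization_eq_self_of_not_dvd p hN hpM)]
  exact h

/-- **`λ(p) = −p^{1−k/2} a_p(f)` for a newform and `p ∥ N`** (Knapp 1993, Thm. 9.27:
"`c_p = −p^{k/2−1} λ(p)` if `p ∣ N` and `p² ∤ N`"), for the eigenvalue `atkinLehnerEigenvalueAt f p`.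
[cite: Knapp1993, Thm. 9.27] -/
theorem IsNewform0.atkinLehnerEigenvalueAt_eq_of_not_dvd {M : ℕ} (hN : N = p * M) (hpM : ¬ p ∣ M)
    {f : CuspForm (Gamma0 N) k} (hf : IsNewform0 f) :
    atkinLehnerEigenvalueAt f p =
      -((((p : ℝ) ^ (1 - (k : ℝ) / 2) : ℝ) : ℂ)) * (qExpansion 1 ⇑f).coeff p := by
  haveI : NeZero p := ⟨(Fact.out : p.Prime).ne_zero⟩
  have hf0 : f ≠ 0 := fun h0 ↦ hf.coe_ne_zero (by rw [h0]; rfl)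
  refine atkinLehnerEigenvalueAt_eq_of_eq_smul hf0 ?_
  rw [atkinLehnerInvolutionAt_eq (pow_factorization_eq_self_of_not_dvd p hN hpM)]
  exact hf.atkinLehnerInvolution_eq_smul_of_not_dvd p hN hpM

/-- **Weight `2`, `p ∥ N`: `λ(p) = −a_p(f)`** for a newform `f ∈ S₂(Γ₀(N))` (Knapp 1993, Thm. 9.27
with `k = 2`: `c_p = −λ(p)`). This is the case consumed by elliptic curves: for `f` attached to
`E / ℚ` and `p` of multiplicative reduction, `a_p = 1` (split) or `−1` (non-split), so
`λ(p) = −1`, `+1` respectively, Rohrlich's local root numbers. [cite: Knapp1993, Thm. 9.27] -/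
theorem IsNewform0.atkinLehnerEigenvalueAt_eq_neg_coeff_of_not_dvd {M : ℕ} (hN : N = p * M)
    (hpM : ¬ p ∣ M) {f : CuspForm (Gamma0 N) 2} (hf : IsNewform0 f) :
    atkinLehnerEigenvalueAt f p = -(qExpansion 1 ⇑f).coeff p := by
  rw [hf.atkinLehnerEigenvalueAt_eq_of_not_dvd p hN hpM]
  have : (((p : ℝ) ^ (1 - ((2 : ℤ) : ℝ) / 2) : ℝ) : ℂ) = 1 := by norm_num
  rw [this, neg_one_mul]

end ExactPrime

end Literature.NumberTheory.EllipticCurves.ModularForms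

end
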